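import Literature.NumberTheory.Automorphic.BianchiOrdinaryClassicality
import Literature.NumberTheory.Automorphic.BoundaryRestrictionHecke
import HarnessLib

/-!
# Non-interior Hecke eigenclasses of `GL₂` restrict to boundary eigenclasses

Topic `NumberTheory/Automorphic`; namespace `Literature.NumberTheory.Automorphic` (grouping
sub-namespace `ParallelWeight`, the receptacle of `BianchiOrdinaryClassicality`).  A *proofs* file
(abbreviations with bodies and theorems; no named fact, no instance) supporting the named fact
`bianchi_boundaryEigensystem_isReducible`: the FIRST STEP of its printed proof — "the restriction map
is Hecke-equivariant, so the eigensystem [of a class `ξ ∉ H^q_!`] occurs in `H^q(∂X̄_U, Ṽ_wt)`"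
(Harder 1987, §1; Khare–Thorne 2017, proof of Thm. 6.23) — in the tree's group-cohomology model.

For `GL₂` the Tits building is DISCRETE: the poset `ParallelWeight.ProperSubspace F 2` of proper
non-zero subspaces of `F²` (= `ℙ¹(F)`, the proper `F`-parabolics) is an antichain
(`ParallelWeight.properSubspace_two_eq_of_le`: two lines, one inside the other, coincide), so the
boundary of the Borel–Serre compactification is `∂(X_U) = GL₂(F)\(ℙ¹(F) × GL₂(𝔸_F^∞)/U × e(B))`
and, by `TwistedQuotient.isInterior_iff_bdryRestrict_eq_zero` (`BoundaryRestrictionHecke`),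
`H^q_!(X_U, Ṽ) = ker (r : H^q(X_U, Ṽ) → H^q(GL₂(F), Fun(ℙ¹(F) × GL₂(𝔸_F^∞)/U, V)))`
(`ParallelWeight.mem_interiorCohomology_two_iff`).  Since `r` commutes with every `T_g`
(`ParallelWeight.bdryRestrict_heckeOp`), a non-interior simultaneous eigenclass of the `T_{w,j}`
restricts to a NON-ZERO simultaneous eigenclass of the boundary cohomology with the same eigenvalues
(`ParallelWeight.bdryRestrict_ne_zero_and_eigen_two`, stated for `GL₂` over any number field and
any coefficient field, so that it applies verbatim to the binders of the named fact).

## Main definitions and results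

* `ParallelWeight.bdryCohomology E F n wt U q = H^q(GL_n(F), Fun(N(P)₀ × GL_n(𝔸_F^∞)/U, V_wt(E)))`,
  `P = ProperSubspace F n`; `bdryRestrict` (the restriction `r`), `bdryHeckeOp`, `bdryHeckeT`
  (`T_g`, `T_{w,j}` on it) — instances of the `TwistedQuotient` layer.
* `ParallelWeight.bdryRestrict_heckeOp`, `bdryRestrict_heckeT` — `r (T_g ξ) = T_g (r ξ)`.
* `ParallelWeight.properSubspace_two_eq_of_le` — `ℙ¹(F)` is an antichain.
* `ParallelWeight.mem_interiorCohomology_two_iff` — `ξ ∈ H^q_! ↔ r ξ = 0` for `GL₂`.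
* `ParallelWeight.bdryRestrict_ne_zero_and_eigen_two` — the first step of the proof of
  `bianchi_boundaryEigensystem_isReducible`.

Not here (the remaining steps of that proof): Shapiro's lemma `H^q(GL₂(F), Fun(ℙ¹(F) × 𝒢/U, V)) ≅
H^q(B(F), Fun(𝒢/U, V))`, Harder's computation of the latter as a Hecke module, and the Galois
characters of the resulting algebraic Hecke characters.

## References

* G. Harder, *Eisenstein cohomology of arithmetic groups. The case GL₂*, Invent. Math. 89 (1987), §1
  [Harder1987].
* C. Khare, J. Thorne, Amer. J. Math. 139 (2017), §6.5, proof of Thm. 6.23 [KhareThorne2017].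
* J. Schwermer, Bull. AMS 47 (2010), §5.3, §12.2 [Schwermer2010].
-/

noncomputable section

open scoped NumberField
open IsDedekindDomain

namespace Literature.NumberTheory.Automorphic

namespace ParallelWeight

/-! ### `ℙ¹(F)` is an antichain -/

/-- **Two lines of `F²`, one contained in the other, are equal**: the poset `ProperSubspace F 2` of
proper non-zero subspaces of `F²` (the Tits building of `GL₂/F`, i.e. `ℙ¹(F)`) is an antichain
(dimension count: `1 ≤ dim W ≤ dim W' ≤ 1`). [folklore] -/
theorem properSubspace_two_eq_of_le (F : Type) [Field F] (W W' : ProperSubspace F 2) (h : W ≤ W') :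
    W = W' := by
  obtain ⟨W, hW0, hWt⟩ := W
  obtain ⟨W', hW0', hWt'⟩ := W'
  change W ≤ W' at h
  refine Subtype.ext (Submodule.eq_of_le_of_finrank_le h ?_)
  have hlt : Module.finrank F W' < 2 := by
    have := Submodule.finrank_lt hWt'
    rwa [Module.finrank_fin_fun] at this
  have hpos : 1 ≤ Module.finrank F W := Submodule.one_le_finrank_iff.mpr hW0
  change Module.finrank F W' ≤ Module.finrank F W
  omega

/-! ### The boundary cohomology of `X_U` (column `0`) and its Hecke operators -/

variable (E : Type) [Field E] (F : Type) [Field F] (n : ℕ) (wt : Fin n → ℤ) [NumberField F]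
  (U : Subgroup (BigHeckeGLn.FiniteAdelicGL n F))

/-- **`H^q(GL_n(F), Fun(N(P)₀ × GL_n(𝔸_F^∞)/U, V_wt(E)))`**, `P = ProperSubspace F n`: column `0` of
the boundary double complex of `X_U` with coefficients `Ṽ_wt` — for `n = 2` the cohomology of the
Borel–Serre boundary `H^q(∂X̄_U, Ṽ_wt)` itself (`TwistedQuotient.bdryCohomology`).
[cite: Schwermer2010, §5.3 and §12.2] -/
abbrev bdryCohomology (q : ℕ) : ModuleCat E :=
  TwistedQuotient.bdryCohomology (V := CoeffModule E F n wt) (BigHeckeGLn.globalEmbedding n F) U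
    (coeffRep E F n wt) (ProperSubspace F n) (smul_properSubspace_mono F n) q

/-- **The restriction to the boundary** `r : H^q(X_U, Ṽ_wt) → H^q(GL_n(F), Fun(N(P)₀ × 𝒢/U, V_wt))`
as an `E`-linear map (`TwistedQuotient.bdryRestrict`). [cite: Harder1987, §1] [cite: Schwermer2010, §5.3] -/
abbrev bdryRestrict (q : ℕ) : cohomology E F n wt U q →ₗ[E] bdryCohomology E F n wt U q :=
  (TwistedQuotient.bdryRestrict (V := CoeffModule E F n wt) (BigHeckeGLn.globalEmbedding n F) U
    (coeffRep E F n wt) (ProperSubspace F n) (smul_properSubspace_mono F n) q).hom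

/-- The Hecke operator `T_g = [U g U]` on the boundary cohomology (`TwistedQuotient.bdryHeckeEnd`).
[cite: Schwermer2010, §5.3] -/
abbrev bdryHeckeOp (q : ℕ) (g : BigHeckeGLn.FiniteAdelicGL n F) :
    Module.End E (bdryCohomology E F n wt U q) :=
  TwistedQuotient.bdryHeckeEnd (V := CoeffModule E F n wt) (BigHeckeGLn.globalEmbedding n F) U
    (coeffRep E F n wt) (ProperSubspace F n) (smul_properSubspace_mono F n) g q

/-- **`T_{w,j} = [U t_{w,j} U]`** on the boundary cohomology (same element `heckeElement n F w j` as
`ParallelWeight.heckeT`). [cite: KhareThorne2017, §6.2] -/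
abbrev bdryHeckeT (q : ℕ) (w : HeightOneSpectrum (𝓞 F)) (j : ℕ) :
    Module.End E (bdryCohomology E F n wt U q) :=
  bdryHeckeOp E F n wt U q (BigHeckeGLn.heckeElement n F w j)

/-- **Restriction to the boundary is Hecke-equivariant**: `r (T_g ξ) = T_g (r ξ)`.
[cite: Harder1987, §1] -/
theorem bdryRestrict_heckeOp (q : ℕ) (g : BigHeckeGLn.FiniteAdelicGL n F)
    (ξ : cohomology E F n wt U q) :
    bdryRestrict E F n wt U q (heckeOp E F n wt U q g ξ) =
      bdryHeckeOp E F n wt U q g (bdryRestrict E F n wt U q ξ) :=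
  TwistedQuotient.bdryRestrict_heckeEnd_apply _ _ _ _ _ g q ξ

/-- `r (T_{w,j} ξ) = T_{w,j} (r ξ)`. [cite: Harder1987, §1] -/
theorem bdryRestrict_heckeT (q : ℕ) (w : HeightOneSpectrum (𝓞 F)) (j : ℕ)
    (ξ : cohomology E F n wt U q) :
    bdryRestrict E F n wt U q (heckeT E F n wt U q w j ξ) =
      bdryHeckeT E F n wt U q w j (bdryRestrict E F n wt U q ξ) :=
  bdryRestrict_heckeOp E F n wt U q _ ξ

/-- An eigenclass of `T_{w,j}` restricts to an eigenclass of `T_{w,j}` on the boundary, same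
eigenvalue. [folklore] -/
theorem bdryHeckeT_bdryRestrict_of_eigen (q : ℕ) (w : HeightOneSpectrum (𝓞 F)) (j : ℕ)
    {ξ : cohomology E F n wt U q} {a : E} (h : heckeT E F n wt U q w j ξ = a • ξ) :
    bdryHeckeT E F n wt U q w j (bdryRestrict E F n wt U q ξ) = a • bdryRestrict E F n wt U q ξ := by
  rw [← bdryRestrict_heckeT, h, map_smul]

/-! ### `GL₂`: `H^q_! = ker r`, and non-interior eigenclasses -/

/-- **`H^q_!(X_U, Ṽ_wt) = ker r` for `GL₂`** over a number field `F`: a class is interior iff its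
restriction to `H^q(GL₂(F), Fun(ℙ¹(F) × GL₂(𝔸_F^∞)/U, V_wt))` vanishes (the Tits building `ℙ¹(F)`
is discrete). [cite: Harder1987, §1] [cite: Schwermer2010, §5.3] -/
theorem mem_interiorCohomology_two_iff (wt : Fin 2 → ℤ) (U : Subgroup (BigHeckeGLn.FiniteAdelicGL 2 F))
    (q : ℕ) (ξ : cohomology E F 2 wt U q) :
    ξ ∈ interiorCohomology E F 2 wt U q ↔ bdryRestrict E F 2 wt U q ξ = 0 :=
  TwistedQuotient.mem_interiorCohomology_iff_bdryRestrict_eq_zero _ _ _ _ _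
    (properSubspace_two_eq_of_le F) q ξ

/-- **A non-interior class of `GL₂` has non-zero restriction to the boundary.** [cite: Harder1987, §1] -/
theorem bdryRestrict_ne_zero_of_not_mem_two (wt : Fin 2 → ℤ)
    (U : Subgroup (BigHeckeGLn.FiniteAdelicGL 2 F)) (q : ℕ) {ξ : cohomology E F 2 wt U q}
    (hξ : ξ ∉ interiorCohomology E F 2 wt U q) : bdryRestrict E F 2 wt U q ξ ≠ 0 :=
  fun h => hξ ((mem_interiorCohomology_two_iff E F wt U q ξ).mpr h)

/-- **First step of the proof of `bianchi_boundaryEigensystem_isReducible`** (`GL₂` over any number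
field, any coefficient field): a class `ξ ∉ H^q_!(X_U, Ṽ_wt)` which is an eigenvector of
`T_{w,1}, T_{w,2}` for almost all `w` restricts to a NON-ZERO class of the boundary cohomology
`H^q(GL₂(F), Fun(ℙ¹(F) × GL₂(𝔸_F^∞)/U, V_wt))` which is an eigenvector of the boundary `T_{w,1}, T_{w,2}`
with the SAME eigenvalues for the same `w`. [cite: Harder1987, §1] [cite: KhareThorne2017, §6.5, proof of Thm. 6.23] -/
theorem bdryRestrict_ne_zero_and_eigen_two (wt : Fin 2 → ℤ)
    (U : Subgroup (BigHeckeGLn.FiniteAdelicGL 2 F)) (q : ℕ) {ξ : cohomology E F 2 wt U q}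
    (hξ : ξ ∉ interiorCohomology E F 2 wt U q) (a : HeightOneSpectrum (𝓞 F) → ℕ → E)
    (ha : ∀ᶠ w in Filter.cofinite,
      heckeT E F 2 wt U q w 1 ξ = a w 1 • ξ ∧ heckeT E F 2 wt U q w 2 ξ = a w 2 • ξ) :
    bdryRestrict E F 2 wt U q ξ ≠ 0 ∧
      ∀ᶠ w in Filter.cofinite,
        bdryHeckeT E F 2 wt U q w 1 (bdryRestrict E F 2 wt U q ξ) = a w 1 • bdryRestrict E F 2 wt U q ξ ∧
        bdryHeckeT E F 2 wt U q w 2 (bdryRestrict E F 2 wt U q ξ) = a w 2 • bdryRestrict E F 2 wt U q ξ :=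
  ⟨bdryRestrict_ne_zero_of_not_mem_two E F wt U q hξ,
    ha.mono fun w hw =>
      ⟨bdryHeckeT_bdryRestrict_of_eigen E F 2 wt U q w 1 hw.1,
        bdryHeckeT_bdryRestrict_of_eigen E F 2 wt U q w 2 hw.2⟩⟩

end ParallelWeight

end Literature.NumberTheory.Automorphic
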